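import Summits.NavierStokesRegularity.NavierStokesRegularity.Theses.AxisymmetricExtremality

/-!
# Strategist census s14-g3 (family `s`, gen 3, independent) — typed companion

Crux `AxisymmetricExtremality.AxisymmetricKatoGlobal` (item stmt-NavierStokesRegularity-15453).
Every statement below is over existing declarations; every `theorem` is sorry-free pure logic.
Sections follow the census headings: weaker intermediate · decomposition · strengthen · transfer.
Nothing here is a new route, a new item, or a claim on the crux.
-/

namespace Summit.NavierStokesRegularity.NavierStokesRegularity.Cruxes.AxisymmetricKatoGlobal.StrategistS14g3

open Summit.NavierStokesRegularity.NavierStokesRegularity.Theses.AxisymmetricExtremality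
open Literature.Analysis.FluidPDE Literature.Analysis.FunctionSpaces
open MeasureTheory Set Function
open scoped ENNReal

/-- `ℝ³` as used by the route. -/
abbrev R3 : Type := EuclideanSpace ℝ (Fin 3)
/-- `ℂ³` (target of `complexify`). -/
abbrev C3 : Type := EuclideanSpace ℂ (Fin 3)

/-- Rotation-equivariance about the `x 2`-axis — VERBATIM the symmetry clause of the crux
(`= IsAxisymmetric u₀`, `Iff.rfl` in the route's Sketch). -/
def RotEquivariant (u₀ : R3 → R3) : Prop :=
  ∀ (θ : ℝ) (x : R3), u₀ (WithLp.toLp 2 ![Real.cos θ * x 0 - Real.sin θ * x 1, Real.sin θ * x 0 + Real.cos θ * x 1, x 2]) = WithLp.toLp 2 ![Real.cos θ * u₀ x 0 - Real.sin θ * u₀ x 1, Real.sin θ * u₀ x 0 + Real.cos θ * u₀ x 1, u₀ x 2]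

/-- The crux restricted to a data class `P` (used to state strata / levels). -/
def AKGOn (P : ℝ → (R3 → R3) → HomSobolev R3 C3 (1 / 2 : ℝ) → Prop) : Prop :=
  ∀ ν : ℝ, 0 < ν → ∀ (u₀ : R3 → R3) (g : HomSobolev R3 C3 (1 / 2 : ℝ)),
    MemLp u₀ 3 volume → g.Represents (Literature.Analysis.FunctionSpaces.EuclideanSpace.complexify ∘ u₀) →
    IsWeaklyDivFree u₀ → RotEquivariant u₀ → P ν u₀ g → HasGlobalKatoSolution ν u₀

/-- The crux is `AKGOn` of the trivial class (definitional bookkeeping). -/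
theorem akg_iff_AKGOn_true : AxisymmetricKatoGlobal ↔ AKGOn (fun _ _ _ => True) := by
  constructor
  · intro h ν hν u₀ g h1 h2 h3 h4 _
    exact h ν hν u₀ g h1 h2 h3 h4
  · intro h ν hν u₀ g h1 h2 h3 h4
    exact h ν hν u₀ g h1 h2 h3 h4 trivial

/-! ## 1. Weaker intermediate read off the summit: the threshold instance W₀ -/

/-- **W₀** — no axisymmetric Rusin–Šverák minimal blow-up datum, at any viscosity. This is the ONLY
instance of the crux that `closes` consumes. -/
def NoAxisymMinimalBlowupDatum : Prop :=
  ∀ ν : ℝ, 0 < ν → ∀ (u₀ : R3 → R3) (g : HomSobolev R3 C3 (1 / 2 : ℝ)),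
    IsMinimalBlowupDatum ν u₀ g → RotEquivariant u₀ → False

/-- The crux implies W₀ (one line). -/
theorem W0_of_AKG (h : AxisymmetricKatoGlobal) : NoAxisymMinimalBlowupDatum := by
  intro ν hν u₀ g hmin hax
  obtain ⟨hL3, hrep, hdiv, -, hnot⟩ := hmin
  exact hnot (h ν hν u₀ g hL3 hrep hdiv hax)

/-- W₀ re-glues the route: the deciding theorem with W₀ in place of the crux (same pure logic as
`closes`). So the route NEEDS only W₀. -/
theorem closes_of_W0 (h₂ : MinimalDatumPFold) (h₄ : PFoldToAxisymmetric)
    (h₃ : NoAxisymMinimalBlowupDatum) : NavierStokesRegularity := by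
  show Literature.NS.NavierStokesExistenceSmoothR3
  intro ν hν u₀ hsm hdiv hdec
  by_contra hno
  obtain ⟨u₁, g, hmin, hax⟩ := h₄ ν hν (h₂ ν hν ⟨u₀, hsm, hdiv, hdec, hno⟩)
  exact h₃ ν hν u₁ g hmin hax

/-- W₀ in "threshold-sphere" form: axisymmetric data ON the sphere `‖g‖ = ρ_max^pure(ν)` are global. -/
def AKGOnThresholdSphere : Prop :=
  AKGOn (fun ν _ g => ‖g‖ₑ = rusinSverakRhoMaxPure ν)

theorem W0_iff_sphere : NoAxisymMinimalBlowupDatum ↔ AKGOnThresholdSphere := by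
  constructor
  · intro h ν hν u₀ g h1 h2 h3 h4 h5
    by_contra hng
    exact h ν hν u₀ g ⟨h1, h2, h3, h5, hng⟩ h4
  · intro h ν hν u₀ g hmin hax
    obtain ⟨h1, h2, h3, h5, hng⟩ := hmin
    exact hng (h ν hν u₀ g h1 h2 h3 hax h5)

/-- The off-threshold remainder: axisymmetric data with `‖g‖ ≠ ρ_max^pure(ν)` are global. Below the
threshold this is the definition of `ρ_max^pure`; ABOVE it is "strict non-extremality of the
axisymmetric class" — the disjunct with no known mechanism. -/
def AKGOffThreshold : Prop :=
  AKGOn (fun ν _ g => ‖g‖ₑ ≠ rusinSverakRhoMaxPure ν)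

/-- Exact bookkeeping of the gap: crux = W₀ ∧ (off-threshold part). -/
theorem akg_iff_W0_and_off : AxisymmetricKatoGlobal ↔ NoAxisymMinimalBlowupDatum ∧ AKGOffThreshold := by
  constructor
  · intro h
    exact ⟨W0_of_AKG h, fun ν hν u₀ g h1 h2 h3 h4 _ => h ν hν u₀ g h1 h2 h3 h4⟩
  · rintro ⟨hW, hoff⟩ ν hν u₀ g h1 h2 h3 h4
    by_cases heq : ‖g‖ₑ = rusinSverakRhoMaxPure ν
    · by_contra hng
      exact hW ν hν u₀ g ⟨h1, h2, h3, heq, hng⟩ h4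
    · exact hoff ν hν u₀ g h1 h2 h3 h4 heq

/-- The sub-threshold stratum is already a theorem (definition of the threshold): no content there. -/
theorem akgOn_below_threshold : AKGOn (fun ν _ g => ‖g‖ₑ < rusinSverakRhoMaxPure ν) :=
  fun _ _ _ _ h1 h2 h3 _ hlt => hasGlobalKatoSolution_of_lt_rusinSverakRhoMaxPure h1 h2 h3 hlt

/-! ## 2. Decomposition attempt: induction on the swirl level `‖Γ‖_∞ = ‖r u_θ‖_∞` (units of ν)

`Γ(x) = x₀ u₁(x) − x₁ u₀(x)` is the tree's junk-free `swirl` written inline (no extra import). -/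

/-- The swirl level of a datum: `‖x₀ u₁ − x₁ u₀‖_{L^∞}` (∞ allowed). -/
noncomputable def swirlLevel (u₀ : R3 → R3) : ℝ≥0∞ :=
  eLpNorm (fun x : R3 => x 0 * u₀ x 1 - x 1 * u₀ x 0) ∞ volume

/-- The crux at swirl level `≤ Λ ν` (scale- and viscosity-normalised). -/
def AKGLevel (Λ : ℝ) : Prop :=
  AKGOn (fun ν u₀ _ => swirlLevel u₀ ≤ ENNReal.ofReal (Λ * ν))

/-- Piece S — ABSOLUTE small swirl: some level `ε > 0` is global. OPEN ("beyond the reach of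
existing methods", Lei–Ren 2024 p. 6; known only RELATIVE smallness / log-modulus forms). -/
def SmallSwirlGlobal : Prop := ∃ ε : ℝ, 0 < ε ∧ AKGLevel ε

/-- Piece C — uniform level continuation: a fixed increment `δ ν` of admissible swirl level.
As typed this is crux-sized: no quantity distinguishes level Λ from Λ + δ (see census §2). -/
def SwirlLevelContinuation : Prop := ∃ δ : ℝ, 0 < δ ∧ ∀ Λ : ℝ, AKGLevel Λ → AKGLevel (Λ + δ)

/-- Piece L — localisation: bounded-swirl data suffice (singularities sit on the axis inside a
bounded region; a local maximum principle bounds Γ there from a positive time on). M-sized. -/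
def BoundedSwirlReduction : Prop := (∀ Λ : ℝ, AKGLevel Λ) → AxisymmetricKatoGlobal

/-- Monotonicity of the levels (bookkeeping). -/
theorem akgLevel_mono {Λ Λ' : ℝ} (hle : Λ ≤ Λ') (h : AKGLevel Λ') : AKGLevel Λ := by
  intro ν hν u₀ g h1 h2 h3 h4 h5
  refine h ν hν u₀ g h1 h2 h3 h4 (le_trans h5 ?_)
  exact ENNReal.ofReal_le_ofReal (mul_le_mul_of_nonneg_right hle hν.le)

/-- All levels from S + C (induction on `n`, Archimedes). -/
theorem akgLevel_all (hS : SmallSwirlGlobal) (hC : SwirlLevelContinuation) : ∀ Λ : ℝ, AKGLevel Λ := by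
  obtain ⟨ε, hε, hSε⟩ := hS
  obtain ⟨δ, hδ, hstep⟩ := hC
  have hn : ∀ n : ℕ, AKGLevel (ε + n * δ) := by
    intro n
    induction n with
    | zero => simpa using hSε
    | succ k ih =>
      have := hstep _ ih
      simpa [Nat.cast_succ, add_mul, one_mul, add_assoc] using this
  intro Λ
  obtain ⟨n, hnΛ⟩ := exists_nat_ge (Λ / δ)
  refine akgLevel_mono ?_ (hn n)
  have : Λ ≤ n * δ := by
    rw [div_le_iff₀ hδ] at hnΛ
    exact hnΛ
  linarith

/-- **Assembly of the split (proved): S → C → L → crux.** The split is genuine as logic; the census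
records why it gives no leverage (S open and itself "beyond reach", C crux-sized). -/
theorem AKG_of_swirlLevelInduction (hS : SmallSwirlGlobal) (hC : SwirlLevelContinuation)
    (hL : BoundedSwirlReduction) : AxisymmetricKatoGlobal :=
  hL (akgLevel_all hS hC)

/-- Converse bookkeeping: the crux gives every piece (so the split loses nothing). -/
theorem pieces_of_AKG (h : AxisymmetricKatoGlobal) :
    SmallSwirlGlobal ∧ SwirlLevelContinuation ∧ BoundedSwirlReduction := by
  have hlev : ∀ Λ : ℝ, AKGLevel Λ := fun Λ ν hν u₀ g h1 h2 h3 h4 _ => h ν hν u₀ g h1 h2 h3 h4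
  exact ⟨⟨1, one_pos, hlev 1⟩, ⟨1, one_pos, fun Λ _ => hlev (Λ + 1)⟩, fun _ => h⟩

/-! ## 3. Strengthen attempt: the quantitative (Kenig–Merle-ready) form S⁺ -/

/-- **S⁺** — global Kato solution WITH a bound on `sup_t ‖u(t)‖_{L³}` depending only on the datum's
`Ḣ^{1/2}` norm (and ν). Admits "induction on the critical norm" (Kenig–Merle / Kenig–Koch /
Gallagher–Koch–Planchon): failure ⇒ a critical element with precompact orbit mod scaling; the
rigidity step is then a Liouville theorem for axisymmetric critical elements — open (KNSS
conjecture class), see census §3. -/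
def AKGQuantitative : Prop :=
  ∀ ν : ℝ, 0 < ν → ∃ F : ℝ≥0∞ → ℝ≥0∞, (∀ ρ : ℝ≥0∞, ρ < ⊤ → F ρ < ⊤) ∧
    ∀ (u₀ : R3 → R3) (g : HomSobolev R3 C3 (1 / 2 : ℝ)),
      MemLp u₀ 3 volume → g.Represents (Literature.Analysis.FunctionSpaces.EuclideanSpace.complexify ∘ u₀) →
      IsWeaklyDivFree u₀ → RotEquivariant u₀ →
      ∃ u : ℝ → R3 → R3, IsGlobalMildSolution ν 0 u₀ u ∧ ContinuousInLpOn (Ici 0) 3 u ∧ u 0 = u₀ ∧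
        AEStronglyMeasurable (uncurry u) (volume.restrict (Ioi 0 ×ˢ univ)) ∧
        ∀ t : ℝ, 0 ≤ t → eLpNorm (u t) 3 volume ≤ F ‖g‖ₑ

/-- S⁺ ⇒ crux (drop the bound). -/
theorem AKG_of_quantitative (h : AKGQuantitative) : AxisymmetricKatoGlobal := by
  intro ν hν u₀ g h1 h2 h3 h4
  obtain ⟨F, -, hF⟩ := h ν hν
  obtain ⟨u, hmild, hcont, h0, hmeas, -⟩ := hF u₀ g h1 h2 h3 h4
  exact ⟨u, hmild, hcont, h0, hmeas⟩

/-! ## 4. Transfer bookkeeping: the solved sibling stratum (no swirl) as a level-0 statement -/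

/-- The swirl-free stratum in level language: level 0 (Γ ≡ 0 a.e.). In tree this is the landed
theorem `…Theorems.AxisymmetricKatoGlobal.NoSwirlStratum.axisymmetricKatoGlobal_noSwirl_stratum`
(stated with `HasNoSwirl`, i.e. Γ ≡ 0 everywhere; the a.e. upgrade is routine via
`HasGlobalKatoSolution.congr_datum_ae`). Not re-proved here (this file imports only the route). -/
def NoSwirlStratum : Prop := AKGLevel 0

/-- Level 0 is implied by small-swirl (bookkeeping: the sibling is the base of the ladder, and the
ladder's first OPEN rung is any ε > 0). -/
theorem noSwirlStratum_of_small (hS : SmallSwirlGlobal) : NoSwirlStratum := by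
  obtain ⟨ε, hε, h⟩ := hS
  exact akgLevel_mono hε.le h

end Summit.NavierStokesRegularity.NavierStokesRegularity.Cruxes.AxisymmetricKatoGlobal.StrategistS14g3
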